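import Summits.HodgeConjecture.HodgeConjecture.Theorems.F0P6aStubFROBRoofGeoWiringAdapters
import HarnessLib

/-!
# `F0P6aStubFROBRoofGeoWiringHoleDischargers` — ★ RE-HOME of `Lines/F0_P6a_StubFROBRoofGeoWiring.lean` (tree sha16 46cdc102588d6598), PART 3 of 4 — tree lines :634–:902.

See PART 1 `Theorems/F0P6aStubFROBRoofGeoWiringWiring.lean` for the full ★ re-home header and the original module docstring (verbatim there).  Same namespace (every fully-qualified name unchanged);
the scopes open at the cut (`noncomputable section` ∕ `namespace` ∕ `section`s) are re-opened below with their `variable` ∕ `open` ∕ `set_option` ∕ `omit` ∕ `include` ∕ `universe` lines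
replayed verbatim from the tree, in order; the code after the replay block is the tree bytes :634–:902, untouched.  HC_CM is proved only modulo the 7 printed citations (2 remaining: hLiu418 = stmt-HodgeConjecture-24832, h413 = stmt-HodgeConjecture-24833) until rung 0 closes; a re-home is count-neutral.
-/

-- ── replay of the scopes open at tree line :634 (verbatim) ──
set_option autoImplicit false
set_option linter.dupNamespace false
set_option linter.unusedSectionVars false
noncomputable section
namespace Summit.HodgeConjecture.HodgeConjecture.Cruxes.HLiu418.F0P6aStubFROBRoofGeoWiring
open CategoryTheory CategoryTheory.Limits NumberField IsDedekindDomain MulAction AlgebraicGeometry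
open scoped Matrix Pointwise MonoidalCategory MonObj CategoryTheory.Obj Polynomial
open Literature.NumberTheory.GaloisRepresentations
open Literature.NumberTheory.Automorphic Literature.NumberTheory.Automorphic.UnitaryGroup
open Literature.AlgebraicGeometry.ShimuraVarieties.UnitaryCanonicalModel
open Literature.NumberTheory.Automorphic.Liu2021.AppendixC
open Literature.AlgebraicGeometry.Motives (AlgPoints IntegralModel SchemeOver thickening thickeningLift specOver relFrobeniusOver frobeniusTwistOver frobSpec)
open Literature.NumberTheory.DiophantineGeometry (geomResidueField specialFibreFunctor specResidueField)
open Literature.AlgebraicGeometry.RelativeSpec (ActionOver)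
open Literature.AlgebraicGeometry.GroupSchemes Literature.AlgebraicGeometry.GroupSchemes.GroupSchemeKernel
open Literature.AlgebraicGeometry.GroupSchemes.AffineGroupScheme (Alg quotIncl)
open Literature.AlgebraicGeometry.AbelianSchemes Literature.AlgebraicGeometry.AbelianSchemes.AbelianSchemeOver
open Summit.HodgeConjecture.HodgeConjecture.Cruxes.HLiu418.F0P6aModuliDatumDefs
open Summit.HodgeConjecture.HodgeConjecture.Cruxes.HLiu418.F0P6aRGDAssembly
open Summit.HodgeConjecture.HodgeConjecture.Cruxes.HLiu418.F0P6aDatumOfInputs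
open Summit.HodgeConjecture.HodgeConjecture.Cruxes.HLiu418.F0P6aLineSpecialisation (spGeoOf)
open Summit.HodgeConjecture.HodgeConjecture.Cruxes.HLiu418.F0P6aRoofCwKernel (hsat_sch₀Of)
open Summit.HodgeConjecture.HodgeConjecture.Cruxes.HLiu418.F0P6aStubFROBRoofGeo
variable {F : Type} [Field F] [NumberField F] [IsCMField F] [IsGalois ℚ F] {ι₁ : F →+* ℂ}
    {Jstar : Matrix (Fin 2) (Fin 2) F}
    {K₀ : C5.OpenCompactSubgroup ↥(finAdelic ↥(maximalRealSubfield F) F (IsCMField.complexConj F) 2 Jstar)}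
    {S : RecordSystemGS F Jstar ι₁ K₀} {hU7ₛ : S.HeckeTranslateDefinedOver}
    {hJ : (Jstar.map (IsCMField.complexConj F))ᵀ = Jstar} {hJu : IsUnit Jstar}
    {Fi : Type} [Field Fi] [Algebra F Fi] {Kc : C5.SmallLevel K₀} {G : Type} [Group G]
    {𝓜 : IntegralModel (𝓞 F) F ((thickening F Fi).obj (S.M.obj Kc))}
    {w : HeightOneSpectrum (𝓞 F)} {hw : (IsCMField.complexConj F) • w ≠ w} {h𝓨 : (𝓜.localise w).IsSmoothProper 1}
    {θ : ActionOver (𝓜.localise w).total.hom ((Fi ≃ₐ[F] Fi) × G)}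
    {e : Fi →ₐ[F] AlgebraicClosure (w.adicCompletion F)}
open Summit.HodgeConjecture.HodgeConjecture.Cruxes.HLiu418.F0P6aLineSpecialisation
  (LineWOf lineWOfKernel lineWOfKernel_le mem_lineWOfKernel_iff natCard_roofKernel_eq roofKernel_stable natCard_roofKernel_inf_idealTorsionΩ_w_eq)
open Literature.NumberTheory.EllipticCurves (genericFibre specGenericPoint)
open Summit.HodgeConjecture.HodgeConjecture.Cruxes.HLiu418.F0P6aStubFROBRoofLegs (roofLegs_of_roofLink_kerRows)
open Literature.AlgebraicGeometry.Motives (extendPoint specValuationSubring specFractionFieldι specRingHomι)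
open Literature.NumberTheory.DiophantineGeometry (toClosureValuationSubring geomClosedPointIsoSpecResidueField)
open Literature.NumberTheory.EllipticCurves (genericFibre specGenericPoint)
open Summit.HodgeConjecture.HodgeConjecture.Cruxes.HLiu418.F0P6aLineSpecialisation (isIdealTorsionΩ_mul_of_roofLink natCard_roofKernel_eq)
-- ── tree bytes :634–:902 ──

section HoleDischargers

set_option backward.isDefEq.respectTransparency false in  -- the (K3₀) row's `= 1` over `(Over.pullback _).obj 𝒦` (W1-a's file-level option)
set_option maxHeartbeats 400000 in
/-- **(C) `HoleKer` FROM THE BLOCK** — `Ker q̄_{y,L} ⊆ A_{red₀ y}[𝔭_w·𝔭_{c•w}]` on ALL `T`-points: the block's (K2₀)′ row at `𝔞 := 𝔭_w·𝔭_{c•w}`, its `Ω̄`-points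
hypothesis «`q(P) = 1 ⇒ ι(𝔭_w𝔭_{c•w}) P = 1`» paid by (r1) `q P = 1 ↔ P ∈ K` and (RKC) `isIdealTorsionΩ_mul_of_roofLink` (★ (ρ2″) `isIdealTorsion_mul_of_roof`: `K ⊆ A_y[𝔭_w𝔭_{c•w}]`,
which needs the three roofs — hence `translΩ hhecke hunit hKc hroof₂` — and `hunr`); `RoofΩ` re-packed from the block's sixteen components.  The seams
`fibreΩOf = (schΩOf).toAffine.toAbelianVariety`, `AlgPoints.map f P = P ≫ f`, `(actΩOf … r y).hom.hom.hom = (raw action).i r` are `rfl`.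
[cite: Liu2021, Prop. D.8 (3) pp. 136–137] [cite: MumfordAV1970, §7 Thm. 4 (p. 72); §23 Thm. 2 (p. 231)] [cite: Shimura1998, §13.1 Thm. 1 (pp. 97–99)] -/
theorem holeKer_of_blk
    (I : RGDInputsAt F ι₁ Jstar K₀ S hU7ₛ hJ hJu Fi Kc G 𝓜 w hw h𝓨 θ e) [ExpChar (geomResidueField w) I.pChar]
    (quotΩ : ∀ y, LineOf I y → AlgPoints (S.M.obj Kc) (AlgebraicClosure (w.adicCompletion F)))
    (translΩ : AlgPoints (S.M.obj Kc) (AlgebraicClosure (w.adicCompletion F)) → AlgPoints (S.M.obj Kc) (AlgebraicClosure (w.adicCompletion F)))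
    (hhecke : HeckeClause I quotΩ translΩ)
    (hunit : (UnitaryGroup.isUnit_placeForm Jstar hJu w).unit ∈ glInt 2 (w.adicCompletion F))
    (hKc : UnitaryGroup.IsHyperspecialAt ↥(maximalRealSubfield F) F (IsCMField.complexConj F) 2 Jstar Kc.1.1 (w.under (𝓞 ↥(maximalRealSubfield F))))
    (hroof : RoofLink I quotΩ) (hroof₂ : RoofLink₂ I translΩ)
    {m : ℕ} (E' : Matrix (Fin m) (Fin m) (𝓞 F)) (hE' : E' * E' = E')
    (qbarOf : QbarTy I quotΩ E' hE') (hmono : HoleMono I quotΩ E' hE' qbarOf)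
    (hblk :
      haveI := I.comm
      haveI : IsProper (𝓜.localise w).total.hom := h𝓨.2
        ∀ (y : AlgPoints (S.M.obj Kc) (AlgebraicClosure (w.adicCompletion F))) (L : LineOf I y),
          haveI := hmono y L
          ∃ K : Subgroup ((fibreΩOf S Kc 𝓜 w e I.univ y).Points (AlgebraicClosure (w.adicCompletion F))),
          (∀ P, P ∈ L.1 ↔ P ∈ K ∧ IsIdealTorsionΩ S Kc 𝓜 w e I.univ I.act y ((IsCMField.complexConj F) • w).asIdeal P) ∧
          ∃ (B : Literature.AlgebraicGeometry.AbelianSchemes.AbelianSchemeOver (AlgebraicGeometry.Spec (CommRingCat.of (AlgebraicClosure (w.adicCompletion F)))))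
            (DB : B.DualPair) (lamB : B.X ⟶ DB.hat.X) (_ : IsMonHom lamB)
            -- J12 INTERFACE PIN (ref1 (g2) e-12): `B̂`'s Poincaré sheaf is normalised along `A × {ε_B̂}` — the unit clause `hD_B` (for a ★ `Polarization` it is ★ `Polarization.nonempty_unitHatSlice_iso`)
            (_ : Nonempty ((AlgebraicGeometry.Scheme.Modules.pullback DB.unitHatSlice).obj DB.P ≅ SheafOfModules.unit _))
            (q : (schΩOf S Kc 𝓜 w e I.univ y).X ⟶ B.X) (_ : IsMonHom q)
            (c : (schΩOf S Kc 𝓜 w e I.univ (quotΩ y L)).X ⟶ B.X) (_ : IsMonHom c),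
            -- (r1) kernel of `q` on `Ω`-points
            (∀ P : (fibreΩOf S Kc 𝓜 w e I.univ y).Points (AlgebraicClosure (w.adicCompletion F)),
                (AlgPoints.map q P : B.toAffine.toAbelianVariety.Points (AlgebraicClosure (w.adicCompletion F))) = 1 ↔ P ∈ K) ∧
            -- (r2) kernel of `c` on `Ω`-points = the `𝔞`-torsion; `c` surjective
            (∀ P : (fibreΩOf S Kc 𝓜 w e I.univ (quotΩ y L)).Points (AlgebraicClosure (w.adicCompletion F)),
                (AlgPoints.map c P : B.toAffine.toAbelianVariety.Points (AlgebraicClosure (w.adicCompletion F))) = 1 ↔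
                  IsIdealTorsionΩ S Kc 𝓜 w e I.univ I.act (quotΩ y L) w.asIdeal P) ∧
            Function.Surjective c.left.base ∧
            -- (r3) polarisations: `q^* λ_B = p • λ_y`, `c^* λ_B = p • λ_y″`
            q ≫ lamB ≫ Literature.AlgebraicGeometry.AbelianSchemes.AbelianSchemeOver.DualPair.dualIsogenyOver q (dualΩOf S Kc 𝓜 w e I.univ I.dual y) DB =
              (polΩOf S Kc 𝓜 w e I.univ I.pol y).lam ≫ (dualΩOf S Kc 𝓜 w e I.univ I.dual y).hat.mulN I.pChar ∧
            c ≫ lamB ≫ Literature.AlgebraicGeometry.AbelianSchemes.AbelianSchemeOver.DualPair.dualIsogenyOver c (dualΩOf S Kc 𝓜 w e I.univ I.dual (quotΩ y L)) DB =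
              (polΩOf S Kc 𝓜 w e I.univ I.pol (quotΩ y L)).lam ≫ (dualΩOf S Kc 𝓜 w e I.univ I.dual (quotΩ y L)).hat.mulN I.pChar ∧
            -- (r4) `𝒪_F`-equivariance through a common endomorphism of `B`
            (∀ a : 𝓞 F, ∃ b : B.X ⟶ B.X,
                (actΩOf S Kc 𝓜 w e I.univ I.act a y).hom.hom.hom ≫ q = q ≫ b ∧ (actΩOf S Kc 𝓜 w e I.univ I.act a (quotΩ y L)).hom.hom.hom ≫ c = c ≫ b) ∧
            -- (r5) level-`N` points correspond
            (∀ a : Fin I.g ⊕ Fin I.g → ZMod I.N,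
                (AlgPoints.map q (lvlPtΩOf S Kc 𝓜 w e I.univ I.lvl y a) : B.toAffine.toAbelianVariety.Points (AlgebraicClosure (w.adicCompletion F))) =
                  AlgPoints.map c (lvlPtΩOf S Kc 𝓜 w e I.univ I.lvl (quotΩ y L) a)) ∧
              -- (K3₀) model KILL along a flat `𝒦 ↪ I.univ_ỹ` over `R = 𝒪_Ω̄` (`ỹ := extendPoint … (ℓ_e y)` the `R`-point extending `y` = LS `liftOf`): if `𝒦_η`, read in `A_y` through ★ (d5)'s three-piece
              -- isomorphism (= LS `isoGenericOf` by `hσΩ`), is killed by the LEG `q`, then `𝒦_s`, read in `sch₀Of … (red₀ y)` (= LS `isoSpecialOf` by `hσκ`), is killed by `q̄` — EXACTLY (KEW) `…_of_kerRow`'s `hK3`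
              (∀ (𝒦 : Over (Spec (.of (closureValuationSubring (w.adicCompletion F))))) (incl : 𝒦 ⟶ (I.univ.baseChange (extendPoint (closureValuationSubring (w.adicCompletion F)) (toClosureValuationSubring w) (𝓜.localise w).total ((𝓜.localise w).modelPointsEquiv.symm (thickeningLift e (S.M.obj Kc) y))).left).X) [Flat 𝒦.hom],
                ((Over.pullback (specFractionFieldι (closureValuationSubring (w.adicCompletion F)) (toClosureValuationSubring w)).left).map incl ≫
                    (I.univ.fibreBaseChangeIso ((𝓜.localise w).genericIso'.inv.left ≫ pullback.fst (𝓜.localise w).total.hom (specGenericPoint (HeightOneSpectrum.valuationSubringAtPrime F w) F)) (thickeningLift e (S.M.obj Kc) y).left ≪≫ I.univ.fibreCongrPtIso ((𝓜.localise w).left_specFractionFieldι_comp_extendPoint_modelPointsEquiv_symm (thickeningLift e (S.M.obj Kc) y)).symm ≪≫ (I.univ.fibreBaseChangeIso (extendPoint (closureValuationSubring (w.adicCompletion F)) (toClosureValuationSubring w) (𝓜.localise w).total ((𝓜.localise w).modelPointsEquiv.symm (thickeningLift e (S.M.obj Kc) y))).left (specFractionFieldι (closureValuationSubring (w.adicCompletion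 F)) (toClosureValuationSubring w)).left).symm).inv.hom.hom.hom) ≫ q = 1 →
                ((Over.pullback ((geomClosedPointIsoSpecResidueField w).inv.left ≫ (specRingHomι (closureValuationSubring (w.adicCompletion F)) (toClosureValuationSubring w) (IsLocalRing.residue (closureValuationSubring (w.adicCompletion F)))).left)).map incl ≫
                    (I.univ.fibreBaseChangeIso (pullback.fst (𝓜.localise w).total.hom (specResidueField w)) ((𝓜.localise w).geomReductionMap (thickeningLift e (S.M.obj Kc) y)).left ≪≫ I.univ.fibreCongrPtIso (((𝓜.localise w).left_geomReductionMap_comp_fst (thickeningLift e (S.M.obj Kc) y)).trans (Category.assoc _ _ _).symm) ≪≫ (I.univ.fibreBaseChangeIso (extendPoint (closureValuationSubring (w.adicCompletion F)) (toClosureValuationSubring w) (𝓜.localise w).total ((𝓜.localise w).modelPointsEquiv.symm (thickeningLift e (S.M.obj Kc) y))).left ((geomClosedPointIsoSpecResidueField w).inv.left ≫ (specRingHomι (closureValuationSubring (w.adicCompletion F)) (toClosureValuationSubring w) (IsLocalRing.residue (closureValuationSubring (w.adicCompletion F)))).left)).symm).inv.hom.hom.hom) ≫ qbarOf y L = 1)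 ∧
              -- (K2₀) for every ideal `𝔞`: `Ker q(Ω̄) ⊆ A_y[𝔞](Ω̄)` on points ⇒ `Ker q̄ ⊆ A_{red₀ y}[𝔞]` on ALL `T`-points (★ currency; `IsIdealTorsionΩ … y 𝔞 Pt` and
              -- `(act₀Of 𝓜 w I.univ I.act r (red₀Of … y)).hom.hom.hom` unfold to the two `.i r` terms by `actΩOf_hom_hom_hom` ∕ `act₀Of_hom_hom_hom` (rfl)); at `𝔞 := 𝔭_w·𝔭_{c•w}` = W3∕W5's `hker`
              (∀ 𝔞 : Ideal (𝓞 F),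
                (∀ Pt : ((I.univ.baseChange ((𝓜.localise w).genericIso'.inv.left ≫ pullback.fst (𝓜.localise w).total.hom (specGenericPoint (HeightOneSpectrum.valuationSubringAtPrime F w) F))).baseChange
                    (thickeningLift e (S.M.obj Kc) y).left).toAffine.toAbelianVariety.Points (AlgebraicClosure (w.adicCompletion F)),
                  (AlgPoints.map q Pt : B.toAffine.toAbelianVariety.Points (AlgebraicClosure (w.adicCompletion F))) = 1 →
                    ∀ r ∈ 𝔞, (AlgPoints.map (((I.act.baseChange ((𝓜.localise w).genericIso'.inv.left ≫ pullback.fst (𝓜.localise w).total.hom (specGenericPoint (HeightOneSpectrum.valuationSubringAtPrime F w) F))).baseChange (thickeningLift e (S.M.obj Kc) y).left).i r) Pt :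
                      ((I.univ.baseChange ((𝓜.localise w).genericIso'.inv.left ≫ pullback.fst (𝓜.localise w).total.hom (specGenericPoint (HeightOneSpectrum.valuationSubringAtPrime F w) F))).baseChange
                        (thickeningLift e (S.M.obj Kc) y).left).toAffine.toAbelianVariety.Points (AlgebraicClosure (w.adicCompletion F))) = 1) →
                ∀ ⦃T : SchemeOver (geomResidueField w)⦄ (z : T ⟶ (sch₀Of 𝓜 w I.univ (red₀Of S Kc 𝓜 w h𝓨 e y)).X),
                  z ≫ qbarOf y L = 1 → ∀ r ∈ 𝔞, z ≫ (act₀Of 𝓜 w I.univ I.act r (red₀Of S Kc 𝓜 w h𝓨 e y)).hom.hom.hom = 1) ∧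
              -- (K4₀) degree, (FIN₀) finiteness, (RK₀) `rk Γ(Ker q̄) = #Ker q(Ω̄)` of the reduced leg
              Literature.AlgebraicGeometry.Motives.AbelianVariety.Hom.kerRank (homOfIsMonHom (qbarOf y L)) = Literature.AlgebraicGeometry.Motives.AbelianVariety.Hom.kerRank (homOfIsMonHom q) ∧
              IsFinite (qbarOf y L).left ∧
              Module.finrank (geomResidueField w) (Literature.AlgebraicGeometry.GroupSchemes.AffineGroupScheme.Alg (Literature.AlgebraicGeometry.GroupSchemes.GroupSchemeKernel.ker (qbarOf y L))) =
                Nat.card (Literature.AlgebraicGeometry.Motives.AbelianVariety.Hom.kerPoints (specOver (AlgebraicClosure (w.adicCompletion F)) (AlgebraicClosure (w.adicCompletion F))) (homOfIsMonHom q)))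
    (hunr : ¬ (w.asIdeal ^ 2 ∣ Ideal.span {((I.pChar : ℕ) : 𝓞 F)})) : HoleKer I quotΩ E' hE' qbarOf := by
  haveI := I.comm
  intro y L T z hz b hb
  obtain ⟨K, hK, B, DB, lamB, iL, hDB, q, iq, c, ic, h1, h2, hsj, h3q, h3c, h4, h5, -, hK2, -, -, -⟩ := hblk y L
  have htors := isIdealTorsionΩ_mul_of_roofLink I quotΩ translΩ hhecke hunit hKc hroof hroof₂ hunr y L K
    ⟨hK, B, DB, lamB, iL, hDB, q, iq, c, ic, h1, h2, hsj, h3q, h3c, h4, h5⟩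
  exact hK2 _ (fun Pt hq r hr => htors Pt ((h1 Pt).1 hq) r hr) z hz b hb

set_option backward.isDefEq.respectTransparency false in  -- the (K3₀) row's `= 1` over `(Over.pullback _).obj 𝒦` (W1-a's file-level option)
set_option maxHeartbeats 400000 in
/-- **(RK) `HoleRkK` FROM THE BLOCK** — `dim_κ̄ Γ(Ker q̄_{y,L}) = p^f · p^f` (W5b §E′ `HoleRkK`'s body, token for token): the block's (RK₀) row `dim Γ(Ker q̄) = #Ker q(Ω̄)`,
then ★ (RK-count) `natCard_kerPoints_eq_mul_self_of_forall_iff_of_natCard_eq_pow_two_mul` over (r1) and (RKC) `natCard_roofKernel_eq` (`#K = p^(2f)`: the three roofs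
`RoofLink (y, L)`, `RoofLink (quotΩ y L, L_b)`, `RoofLink₂ y` ∘ ★ (ρ2‴) — hence `translΩ hhecke hunit hKc hroof₂`); `RoofΩ` re-packed from the block.
[cite: GortzWedhorn2023, (27.1.1)] [cite: MumfordAV1970, §7 Thm. 4 (p. 72); §15 Thm. 1 (p. 143)] [cite: Liu2021, Prop. D.8 (pp. 135–138)] -/
theorem holeRkK_of_blk
    (I : RGDInputsAt F ι₁ Jstar K₀ S hU7ₛ hJ hJu Fi Kc G 𝓜 w hw h𝓨 θ e) [ExpChar (geomResidueField w) I.pChar]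
    (quotΩ : ∀ y, LineOf I y → AlgPoints (S.M.obj Kc) (AlgebraicClosure (w.adicCompletion F)))
    (translΩ : AlgPoints (S.M.obj Kc) (AlgebraicClosure (w.adicCompletion F)) → AlgPoints (S.M.obj Kc) (AlgebraicClosure (w.adicCompletion F)))
    (hhecke : HeckeClause I quotΩ translΩ)
    (hunit : (UnitaryGroup.isUnit_placeForm Jstar hJu w).unit ∈ glInt 2 (w.adicCompletion F))
    (hKc : UnitaryGroup.IsHyperspecialAt ↥(maximalRealSubfield F) F (IsCMField.complexConj F) 2 Jstar Kc.1.1 (w.under (𝓞 ↥(maximalRealSubfield F))))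
    (hroof : RoofLink I quotΩ) (hroof₂ : RoofLink₂ I translΩ)
    {m : ℕ} (E' : Matrix (Fin m) (Fin m) (𝓞 F)) (hE' : E' * E' = E')
    (qbarOf : QbarTy I quotΩ E' hE') (hmono : HoleMono I quotΩ E' hE' qbarOf)
    (hblk :
      haveI := I.comm
      haveI : IsProper (𝓜.localise w).total.hom := h𝓨.2
        ∀ (y : AlgPoints (S.M.obj Kc) (AlgebraicClosure (w.adicCompletion F))) (L : LineOf I y),
          haveI := hmono y L
          ∃ K : Subgroup ((fibreΩOf S Kc 𝓜 w e I.univ y).Points (AlgebraicClosure (w.adicCompletion F))),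
          (∀ P, P ∈ L.1 ↔ P ∈ K ∧ IsIdealTorsionΩ S Kc 𝓜 w e I.univ I.act y ((IsCMField.complexConj F) • w).asIdeal P) ∧
          ∃ (B : Literature.AlgebraicGeometry.AbelianSchemes.AbelianSchemeOver (AlgebraicGeometry.Spec (CommRingCat.of (AlgebraicClosure (w.adicCompletion F)))))
            (DB : B.DualPair) (lamB : B.X ⟶ DB.hat.X) (_ : IsMonHom lamB)
            -- J12 INTERFACE PIN (ref1 (g2) e-12): `B̂`'s Poincaré sheaf is normalised along `A × {ε_B̂}` — the unit clause `hD_B` (for a ★ `Polarization` it is ★ `Polarization.nonempty_unitHatSlice_iso`)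
            (_ : Nonempty ((AlgebraicGeometry.Scheme.Modules.pullback DB.unitHatSlice).obj DB.P ≅ SheafOfModules.unit _))
            (q : (schΩOf S Kc 𝓜 w e I.univ y).X ⟶ B.X) (_ : IsMonHom q)
            (c : (schΩOf S Kc 𝓜 w e I.univ (quotΩ y L)).X ⟶ B.X) (_ : IsMonHom c),
            -- (r1) kernel of `q` on `Ω`-points
            (∀ P : (fibreΩOf S Kc 𝓜 w e I.univ y).Points (AlgebraicClosure (w.adicCompletion F)),
                (AlgPoints.map q P : B.toAffine.toAbelianVariety.Points (AlgebraicClosure (w.adicCompletion F))) = 1 ↔ P ∈ K) ∧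
            -- (r2) kernel of `c` on `Ω`-points = the `𝔞`-torsion; `c` surjective
            (∀ P : (fibreΩOf S Kc 𝓜 w e I.univ (quotΩ y L)).Points (AlgebraicClosure (w.adicCompletion F)),
                (AlgPoints.map c P : B.toAffine.toAbelianVariety.Points (AlgebraicClosure (w.adicCompletion F))) = 1 ↔
                  IsIdealTorsionΩ S Kc 𝓜 w e I.univ I.act (quotΩ y L) w.asIdeal P) ∧
            Function.Surjective c.left.base ∧
            -- (r3) polarisations: `q^* λ_B = p • λ_y`, `c^* λ_B = p • λ_y″`
            q ≫ lamB ≫ Literature.AlgebraicGeometry.AbelianSchemes.AbelianSchemeOver.DualPair.dualIsogenyOver q (dualΩOf S Kc 𝓜 w e I.univ I.dual y) DB =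
              (polΩOf S Kc 𝓜 w e I.univ I.pol y).lam ≫ (dualΩOf S Kc 𝓜 w e I.univ I.dual y).hat.mulN I.pChar ∧
            c ≫ lamB ≫ Literature.AlgebraicGeometry.AbelianSchemes.AbelianSchemeOver.DualPair.dualIsogenyOver c (dualΩOf S Kc 𝓜 w e I.univ I.dual (quotΩ y L)) DB =
              (polΩOf S Kc 𝓜 w e I.univ I.pol (quotΩ y L)).lam ≫ (dualΩOf S Kc 𝓜 w e I.univ I.dual (quotΩ y L)).hat.mulN I.pChar ∧
            -- (r4) `𝒪_F`-equivariance through a common endomorphism of `B`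
            (∀ a : 𝓞 F, ∃ b : B.X ⟶ B.X,
                (actΩOf S Kc 𝓜 w e I.univ I.act a y).hom.hom.hom ≫ q = q ≫ b ∧ (actΩOf S Kc 𝓜 w e I.univ I.act a (quotΩ y L)).hom.hom.hom ≫ c = c ≫ b) ∧
            -- (r5) level-`N` points correspond
            (∀ a : Fin I.g ⊕ Fin I.g → ZMod I.N,
                (AlgPoints.map q (lvlPtΩOf S Kc 𝓜 w e I.univ I.lvl y a) : B.toAffine.toAbelianVariety.Points (AlgebraicClosure (w.adicCompletion F))) =
                  AlgPoints.map c (lvlPtΩOf S Kc 𝓜 w e I.univ I.lvl (quotΩ y L) a)) ∧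
              -- (K3₀) model KILL along a flat `𝒦 ↪ I.univ_ỹ` over `R = 𝒪_Ω̄` (`ỹ := extendPoint … (ℓ_e y)` the `R`-point extending `y` = LS `liftOf`): if `𝒦_η`, read in `A_y` through ★ (d5)'s three-piece
              -- isomorphism (= LS `isoGenericOf` by `hσΩ`), is killed by the LEG `q`, then `𝒦_s`, read in `sch₀Of … (red₀ y)` (= LS `isoSpecialOf` by `hσκ`), is killed by `q̄` — EXACTLY (KEW) `…_of_kerRow`'s `hK3`
              (∀ (𝒦 : Over (Spec (.of (closureValuationSubring (w.adicCompletion F))))) (incl : 𝒦 ⟶ (I.univ.baseChange (extendPoint (closureValuationSubring (w.adicCompletion F)) (toClosureValuationSubring w) (𝓜.localise w).total ((𝓜.localise w).modelPointsEquiv.symm (thickeningLift e (S.M.obj Kc) y))).left).X) [Flat 𝒦.hom],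
                ((Over.pullback (specFractionFieldι (closureValuationSubring (w.adicCompletion F)) (toClosureValuationSubring w)).left).map incl ≫
                    (I.univ.fibreBaseChangeIso ((𝓜.localise w).genericIso'.inv.left ≫ pullback.fst (𝓜.localise w).total.hom (specGenericPoint (HeightOneSpectrum.valuationSubringAtPrime F w) F)) (thickeningLift e (S.M.obj Kc) y).left ≪≫ I.univ.fibreCongrPtIso ((𝓜.localise w).left_specFractionFieldι_comp_extendPoint_modelPointsEquiv_symm (thickeningLift e (S.M.obj Kc) y)).symm ≪≫ (I.univ.fibreBaseChangeIso (extendPoint (closureValuationSubring (w.adicCompletion F)) (toClosureValuationSubring w) (𝓜.localise w).total ((𝓜.localise w).modelPointsEquiv.symm (thickeningLift e (S.M.obj Kc) y))).left (specFractionFieldι (closureValuationSubring (w.adicCompletion F)) (toClosureValuationSubring w)).left).symm).inv.hom.hom.hom) ≫ q = 1 →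
                ((Over.pullback ((geomClosedPointIsoSpecResidueField w).inv.left ≫ (specRingHomι (closureValuationSubring (w.adicCompletion F)) (toClosureValuationSubring w) (IsLocalRing.residue (closureValuationSubring (w.adicCompletion F)))).left)).map incl ≫
                    (I.univ.fibreBaseChangeIso (pullback.fst (𝓜.localise w).total.hom (specResidueField w)) ((𝓜.localise w).geomReductionMap (thickeningLift e (S.M.obj Kc) y)).left ≪≫ I.univ.fibreCongrPtIso (((𝓜.localise w).left_geomReductionMap_comp_fst (thickeningLift e (S.M.obj Kc) y)).trans (Category.assoc _ _ _).symm) ≪≫ (I.univ.fibreBaseChangeIso (extendPoint (closureValuationSubring (w.adicCompletion F)) (toClosureValuationSubring w) (𝓜.localise w).total ((𝓜.localise w).modelPointsEquiv.symm (thickeningLift e (S.M.obj Kc) y))).left ((geomClosedPointIsoSpecResidueField w).inv.left ≫ (specRingHomι (closureValuationSubring (w.adicCompletion F)) (toClosureValuationSubring w) (IsLocalRing.residue (closureValuationSubring (w.adicCompletion F)))).left)).symm).inv.hom.hom.hom) ≫ qbarOf y L = 1) ∧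
              -- (K2₀) for every ideal `𝔞`: `Ker q(Ω̄) ⊆ A_y[𝔞](Ω̄)` on points ⇒ `Ker q̄ ⊆ A_{red₀ y}[𝔞]` on ALL `T`-points (★ currency; `IsIdealTorsionΩ … y 𝔞 Pt` and
              -- `(act₀Of 𝓜 w I.univ I.act r (red₀Of … y)).hom.hom.hom` unfold to the two `.i r` terms by `actΩOf_hom_hom_hom` ∕ `act₀Of_hom_hom_hom` (rfl)); at `𝔞 := 𝔭_w·𝔭_{c•w}` = W3∕W5's `hker`
              (∀ 𝔞 : Ideal (𝓞 F),
                (∀ Pt : ((I.univ.baseChange ((𝓜.localise w).genericIso'.inv.left ≫ pullback.fst (𝓜.localise w).total.hom (specGenericPoint (HeightOneSpectrum.valuationSubringAtPrime F w) F))).baseChange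
                    (thickeningLift e (S.M.obj Kc) y).left).toAffine.toAbelianVariety.Points (AlgebraicClosure (w.adicCompletion F)),
                  (AlgPoints.map q Pt : B.toAffine.toAbelianVariety.Points (AlgebraicClosure (w.adicCompletion F))) = 1 →
                    ∀ r ∈ 𝔞, (AlgPoints.map (((I.act.baseChange ((𝓜.localise w).genericIso'.inv.left ≫ pullback.fst (𝓜.localise w).total.hom (specGenericPoint (HeightOneSpectrum.valuationSubringAtPrime F w) F))).baseChange (thickeningLift e (S.M.obj Kc) y).left).i r) Pt :
                      ((I.univ.baseChange ((𝓜.localise w).genericIso'.inv.left ≫ pullback.fst (𝓜.localise w).total.hom (specGenericPoint (HeightOneSpectrum.valuationSubringAtPrime F w) F))).baseChange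
                        (thickeningLift e (S.M.obj Kc) y).left).toAffine.toAbelianVariety.Points (AlgebraicClosure (w.adicCompletion F))) = 1) →
                ∀ ⦃T : SchemeOver (geomResidueField w)⦄ (z : T ⟶ (sch₀Of 𝓜 w I.univ (red₀Of S Kc 𝓜 w h𝓨 e y)).X),
                  z ≫ qbarOf y L = 1 → ∀ r ∈ 𝔞, z ≫ (act₀Of 𝓜 w I.univ I.act r (red₀Of S Kc 𝓜 w h𝓨 e y)).hom.hom.hom = 1) ∧
              -- (K4₀) degree, (FIN₀) finiteness, (RK₀) `rk Γ(Ker q̄) = #Ker q(Ω̄)` of the reduced leg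
              Literature.AlgebraicGeometry.Motives.AbelianVariety.Hom.kerRank (homOfIsMonHom (qbarOf y L)) = Literature.AlgebraicGeometry.Motives.AbelianVariety.Hom.kerRank (homOfIsMonHom q) ∧
              IsFinite (qbarOf y L).left ∧
              Module.finrank (geomResidueField w) (Literature.AlgebraicGeometry.GroupSchemes.AffineGroupScheme.Alg (Literature.AlgebraicGeometry.GroupSchemes.GroupSchemeKernel.ker (qbarOf y L))) =
                Nat.card (Literature.AlgebraicGeometry.Motives.AbelianVariety.Hom.kerPoints (specOver (AlgebraicClosure (w.adicCompletion F)) (AlgebraicClosure (w.adicCompletion F))) (homOfIsMonHom q))) :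
    haveI := I.comm
    ∀ (y : AlgPoints (S.M.obj Kc) (AlgebraicClosure (w.adicCompletion F))) (L : LineOf I y),
      Module.finrank (geomResidueField w) (Alg (GroupSchemeKernel.ker (qbarOf y L))) = I.pChar ^ I.fDeg * I.pChar ^ I.fDeg := by
  haveI := I.comm
  intro y L
  obtain ⟨K, hK, B, DB, lamB, iL, hDB, q, iq, c, ic, h1, h2, hsj, h3q, h3c, h4, h5, -, -, -, -, hRK⟩ := hblk y L
  exact hRK.trans (natCard_kerPoints_eq_mul_self_of_forall_iff_of_natCard_eq_pow_two_mul q K h1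
    (natCard_roofKernel_eq I quotΩ translΩ hhecke hunit hKc hroof hroof₂ y L K ⟨hK, B, DB, lamB, iL, hDB, q, iq, c, ic, h1, h2, hsj, h3q, h3c, h4, h5⟩))

end HoleDischargers


/-! ## §K — HOLE DISCHARGERS (K) `HoleKill` ← (KE) HEAD-K, (W) `HoleCLW` ← (KEW) HEAD-W FROM THE §A BLOCK (LA3-p03 (g4); each in its own budget) -/

section KillWitness

open Literature.AlgebraicGeometry.Motives (extendPoint specValuationSubring specFractionFieldι specRingHomι)
open Literature.NumberTheory.DiophantineGeometry (geomClosedPointIsoSpecResidueField geomResidueFieldEquiv toClosureValuationSubring)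
open Literature.NumberTheory.EllipticCurves (genericFibre specGenericPoint)
open Summit.HodgeConjecture.HodgeConjecture.Cruxes.HLiu418.F0P6aLineSpecialisation
  (isoGenericOf isoSpecialOf liftOf sΩ sκ left_thickeningLift_comp_genericι_eq left_red₀Of_comp_specialι_eq
   quotIncl_spGeoOf_comp_eq_one_of_kerRow exists_wWitness_of_kerRow)

set_option backward.isDefEq.respectTransparency false in  -- the (K3₀) row's `= 1` over `(Over.pullback _).obj 𝒦` (W1-a's file-level option; §A∕§D idiom)
set_option synthInstance.maxHeartbeats 100000 in
set_option maxHeartbeats 400000 in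
/-- **(K) `HoleKill` FROM THE §A BLOCK** — (KILL) `quotIncl (G₀ x̄) (spGeoOf I 𝔡 y L) ≫ ι₀G ≫ q̄_{y,L} = 1` for every `(y, L)`: the block's kernel `K` with its line clause, the
roof leg `q` with (r1), the (K3₀) row at `q̄ := qbarOf y L`, fed with the (F1) identifications `hσ` to (KE) HEAD-K `quotIncl_spGeoOf_comp_eq_one_of_kerRow` (target monoid
object named in the `sch₀Of` spelling). [cite: Liu2021, Prop. D.8 (3) p. 137] [cite: Tate1997FiniteFlatGroupSchemes, (3.7)] -/
theorem holeKill_of_blk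
    (I : RGDInputsAt F ι₁ Jstar K₀ S hU7ₛ hJ hJu Fi Kc G 𝓜 w hw h𝓨 θ e) [ExpChar (geomResidueField w) I.pChar]
    (𝔡 : ∀ xbar, DockAt I xbar)
    (quotΩ : ∀ y, LineOf I y → AlgPoints (S.M.obj Kc) (AlgebraicClosure (w.adicCompletion F)))
    {m : ℕ} (E' : Matrix (Fin m) (Fin m) (𝓞 F)) (hE' : E' * E' = E')
    (qbarOf : QbarTy I quotΩ E' hE') (hmono : HoleMono I quotΩ E' hE' qbarOf)
    (hblk :
      haveI := I.comm
      haveI : IsProper (𝓜.localise w).total.hom := h𝓨.2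
        ∀ (y : AlgPoints (S.M.obj Kc) (AlgebraicClosure (w.adicCompletion F))) (L : LineOf I y),
          haveI := hmono y L
          ∃ K : Subgroup ((fibreΩOf S Kc 𝓜 w e I.univ y).Points (AlgebraicClosure (w.adicCompletion F))),
          (∀ P, P ∈ L.1 ↔ P ∈ K ∧ IsIdealTorsionΩ S Kc 𝓜 w e I.univ I.act y ((IsCMField.complexConj F) • w).asIdeal P) ∧
          ∃ (B : Literature.AlgebraicGeometry.AbelianSchemes.AbelianSchemeOver (AlgebraicGeometry.Spec (CommRingCat.of (AlgebraicClosure (w.adicCompletion F)))))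
            (DB : B.DualPair) (lamB : B.X ⟶ DB.hat.X) (_ : IsMonHom lamB)
            -- J12 INTERFACE PIN (ref1 (g2) e-12): `B̂`'s Poincaré sheaf is normalised along `A × {ε_B̂}` — the unit clause `hD_B` (for a ★ `Polarization` it is ★ `Polarization.nonempty_unitHatSlice_iso`)
            (_ : Nonempty ((AlgebraicGeometry.Scheme.Modules.pullback DB.unitHatSlice).obj DB.P ≅ SheafOfModules.unit _))
            (q : (schΩOf S Kc 𝓜 w e I.univ y).X ⟶ B.X) (_ : IsMonHom q)
            (c : (schΩOf S Kc 𝓜 w e I.univ (quotΩ y L)).X ⟶ B.X) (_ : IsMonHom c),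
            -- (r1) kernel of `q` on `Ω`-points
            (∀ P : (fibreΩOf S Kc 𝓜 w e I.univ y).Points (AlgebraicClosure (w.adicCompletion F)),
                (AlgPoints.map q P : B.toAffine.toAbelianVariety.Points (AlgebraicClosure (w.adicCompletion F))) = 1 ↔ P ∈ K) ∧
            -- (r2) kernel of `c` on `Ω`-points = the `𝔞`-torsion; `c` surjective
            (∀ P : (fibreΩOf S Kc 𝓜 w e I.univ (quotΩ y L)).Points (AlgebraicClosure (w.adicCompletion F)),
                (AlgPoints.map c P : B.toAffine.toAbelianVariety.Points (AlgebraicClosure (w.adicCompletion F))) = 1 ↔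
                  IsIdealTorsionΩ S Kc 𝓜 w e I.univ I.act (quotΩ y L) w.asIdeal P) ∧
            Function.Surjective c.left.base ∧
            -- (r3) polarisations: `q^* λ_B = p • λ_y`, `c^* λ_B = p • λ_y″`
            q ≫ lamB ≫ Literature.AlgebraicGeometry.AbelianSchemes.AbelianSchemeOver.DualPair.dualIsogenyOver q (dualΩOf S Kc 𝓜 w e I.univ I.dual y) DB =
              (polΩOf S Kc 𝓜 w e I.univ I.pol y).lam ≫ (dualΩOf S Kc 𝓜 w e I.univ I.dual y).hat.mulN I.pChar ∧
            c ≫ lamB ≫ Literature.AlgebraicGeometry.AbelianSchemes.AbelianSchemeOver.DualPair.dualIsogenyOver c (dualΩOf S Kc 𝓜 w e I.univ I.dual (quotΩ y L)) DB =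
              (polΩOf S Kc 𝓜 w e I.univ I.pol (quotΩ y L)).lam ≫ (dualΩOf S Kc 𝓜 w e I.univ I.dual (quotΩ y L)).hat.mulN I.pChar ∧
            -- (r4) `𝒪_F`-equivariance through a common endomorphism of `B`
            (∀ a : 𝓞 F, ∃ b : B.X ⟶ B.X,
                (actΩOf S Kc 𝓜 w e I.univ I.act a y).hom.hom.hom ≫ q = q ≫ b ∧ (actΩOf S Kc 𝓜 w e I.univ I.act a (quotΩ y L)).hom.hom.hom ≫ c = c ≫ b) ∧
            -- (r5) level-`N` points correspond
            (∀ a : Fin I.g ⊕ Fin I.g → ZMod I.N,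
                (AlgPoints.map q (lvlPtΩOf S Kc 𝓜 w e I.univ I.lvl y a) : B.toAffine.toAbelianVariety.Points (AlgebraicClosure (w.adicCompletion F))) =
                  AlgPoints.map c (lvlPtΩOf S Kc 𝓜 w e I.univ I.lvl (quotΩ y L) a)) ∧
              -- (K3₀) model KILL along a flat `𝒦 ↪ I.univ_ỹ` over `R = 𝒪_Ω̄` (`ỹ := extendPoint … (ℓ_e y)` the `R`-point extending `y` = LS `liftOf`): if `𝒦_η`, read in `A_y` through ★ (d5)'s three-piece
              -- isomorphism (= LS `isoGenericOf` by `hσΩ`), is killed by the LEG `q`, then `𝒦_s`, read in `sch₀Of … (red₀ y)` (= LS `isoSpecialOf` by `hσκ`), is killed by `q̄` — EXACTLY (KEW) `…_of_kerRow`'s `hK3`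
              (∀ (𝒦 : Over (Spec (.of (closureValuationSubring (w.adicCompletion F))))) (incl : 𝒦 ⟶ (I.univ.baseChange (extendPoint (closureValuationSubring (w.adicCompletion F)) (toClosureValuationSubring w) (𝓜.localise w).total ((𝓜.localise w).modelPointsEquiv.symm (thickeningLift e (S.M.obj Kc) y))).left).X) [Flat 𝒦.hom],
                ((Over.pullback (specFractionFieldι (closureValuationSubring (w.adicCompletion F)) (toClosureValuationSubring w)).left).map incl ≫
                    (I.univ.fibreBaseChangeIso ((𝓜.localise w).genericIso'.inv.left ≫ pullback.fst (𝓜.localise w).total.hom (specGenericPoint (HeightOneSpectrum.valuationSubringAtPrime F w) F)) (thickeningLift e (S.M.obj Kc) y).left ≪≫ I.univ.fibreCongrPtIso ((𝓜.localise w).left_specFractionFieldι_comp_extendPoint_modelPointsEquiv_symm (thickeningLift e (S.M.obj Kc) y)).symm ≪≫ (I.univ.fibreBaseChangeIso (extendPoint (closureValuationSubring (w.adicCompletion F)) (toClosureValuationSubring w) (𝓜.localise w).total ((𝓜.localise w).modelPointsEquiv.symm (thickeningLift e (S.M.obj Kc) y))).left (specFractionFieldι (closureValuationSubring (w.adicCompletion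 F)) (toClosureValuationSubring w)).left).symm).inv.hom.hom.hom) ≫ q = 1 →
                ((Over.pullback ((geomClosedPointIsoSpecResidueField w).inv.left ≫ (specRingHomι (closureValuationSubring (w.adicCompletion F)) (toClosureValuationSubring w) (IsLocalRing.residue (closureValuationSubring (w.adicCompletion F)))).left)).map incl ≫
                    (I.univ.fibreBaseChangeIso (pullback.fst (𝓜.localise w).total.hom (specResidueField w)) ((𝓜.localise w).geomReductionMap (thickeningLift e (S.M.obj Kc) y)).left ≪≫ I.univ.fibreCongrPtIso (((𝓜.localise w).left_geomReductionMap_comp_fst (thickeningLift e (S.M.obj Kc) y)).trans (Category.assoc _ _ _).symm) ≪≫ (I.univ.fibreBaseChangeIso (extendPoint (closureValuationSubring (w.adicCompletion F)) (toClosureValuationSubring w) (𝓜.localise w).total ((𝓜.localise w).modelPointsEquiv.symm (thickeningLift e (S.M.obj Kc) y))).left ((geomClosedPointIsoSpecResidueField w).inv.left ≫ (specRingHomι (closureValuationSubring (w.adicCompletion F)) (toClosureValuationSubring w) (IsLocalRing.residue (closureValuationSubring (w.adicCompletion F)))).left)).symm).inv.hom.hom.hom) ≫ qbarOf y L = 1)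 ∧
              -- (K2₀) for every ideal `𝔞`: `Ker q(Ω̄) ⊆ A_y[𝔞](Ω̄)` on points ⇒ `Ker q̄ ⊆ A_{red₀ y}[𝔞]` on ALL `T`-points (★ currency; `IsIdealTorsionΩ … y 𝔞 Pt` and
              -- `(act₀Of 𝓜 w I.univ I.act r (red₀Of … y)).hom.hom.hom` unfold to the two `.i r` terms by `actΩOf_hom_hom_hom` ∕ `act₀Of_hom_hom_hom` (rfl)); at `𝔞 := 𝔭_w·𝔭_{c•w}` = W3∕W5's `hker`
              (∀ 𝔞 : Ideal (𝓞 F),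
                (∀ Pt : ((I.univ.baseChange ((𝓜.localise w).genericIso'.inv.left ≫ pullback.fst (𝓜.localise w).total.hom (specGenericPoint (HeightOneSpectrum.valuationSubringAtPrime F w) F))).baseChange
                    (thickeningLift e (S.M.obj Kc) y).left).toAffine.toAbelianVariety.Points (AlgebraicClosure (w.adicCompletion F)),
                  (AlgPoints.map q Pt : B.toAffine.toAbelianVariety.Points (AlgebraicClosure (w.adicCompletion F))) = 1 →
                    ∀ r ∈ 𝔞, (AlgPoints.map (((I.act.baseChange ((𝓜.localise w).genericIso'.inv.left ≫ pullback.fst (𝓜.localise w).total.hom (specGenericPoint (HeightOneSpectrum.valuationSubringAtPrime F w) F))).baseChange (thickeningLift e (S.M.obj Kc) y).left).i r) Pt :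
                      ((I.univ.baseChange ((𝓜.localise w).genericIso'.inv.left ≫ pullback.fst (𝓜.localise w).total.hom (specGenericPoint (HeightOneSpectrum.valuationSubringAtPrime F w) F))).baseChange
                        (thickeningLift e (S.M.obj Kc) y).left).toAffine.toAbelianVariety.Points (AlgebraicClosure (w.adicCompletion F))) = 1) →
                ∀ ⦃T : SchemeOver (geomResidueField w)⦄ (z : T ⟶ (sch₀Of 𝓜 w I.univ (red₀Of S Kc 𝓜 w h𝓨 e y)).X),
                  z ≫ qbarOf y L = 1 → ∀ r ∈ 𝔞, z ≫ (act₀Of 𝓜 w I.univ I.act r (red₀Of S Kc 𝓜 w h𝓨 e y)).hom.hom.hom = 1) ∧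
              -- (K4₀) degree, (FIN₀) finiteness, (RK₀) `rk Γ(Ker q̄) = #Ker q(Ω̄)` of the reduced leg
              Literature.AlgebraicGeometry.Motives.AbelianVariety.Hom.kerRank (homOfIsMonHom (qbarOf y L)) = Literature.AlgebraicGeometry.Motives.AbelianVariety.Hom.kerRank (homOfIsMonHom q) ∧
              IsFinite (qbarOf y L).left ∧
              Module.finrank (geomResidueField w) (Literature.AlgebraicGeometry.GroupSchemes.AffineGroupScheme.Alg (Literature.AlgebraicGeometry.GroupSchemes.GroupSchemeKernel.ker (qbarOf y L))) =
                Nat.card (Literature.AlgebraicGeometry.Motives.AbelianVariety.Hom.kerPoints (specOver (AlgebraicClosure (w.adicCompletion F)) (AlgebraicClosure (w.adicCompletion F))) (homOfIsMonHom q)))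
    (hσ : ∀ y : AlgPoints (S.M.obj Kc) (AlgebraicClosure (w.adicCompletion F)),
      (isoGenericOf I y).inv =
        (I.univ.fibreBaseChangeIso ((𝓜.localise w).genericIso'.inv.left ≫ pullback.fst (𝓜.localise w).total.hom (specGenericPoint (HeightOneSpectrum.valuationSubringAtPrime F w) F))
            (thickeningLift e (S.M.obj Kc) y).left ≪≫
          I.univ.fibreCongrPtIso (left_thickeningLift_comp_genericι_eq S Kc 𝓜 w h𝓨 e y) ≪≫
          (I.univ.fibreBaseChangeIso (liftOf S Kc 𝓜 w h𝓨 e y).left (sΩ w)).symm).inv.hom.hom.hom ∧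
      (isoSpecialOf I y).inv =
        (I.univ.fibreBaseChangeIso (pullback.fst (𝓜.localise w).total.hom (specResidueField w)) (red₀Of S Kc 𝓜 w h𝓨 e y).left ≪≫
          I.univ.fibreCongrPtIso (left_red₀Of_comp_specialι_eq S Kc 𝓜 w h𝓨 e y) ≪≫
          (I.univ.fibreBaseChangeIso (liftOf S Kc 𝓜 w h𝓨 e y).left (sκ w)).symm).inv.hom.hom.hom)
 :
    HoleKill I 𝔡 quotΩ E' hE' qbarOf := by
  haveI := I.comm
  haveI : IsProper (𝓜.localise w).total.hom := h𝓨.2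
  intro y L
  haveI := hmono y L
  have hb := hblk y L
  obtain ⟨K, hK, B, DB, lamB, iL, hDB, q, iq, c, ic, h1, h2, hsj, h3q, h3c, h4, h5, hK3, -, -, -, -⟩ := hb
  haveI := iq
  have hk := quotIncl_spGeoOf_comp_eq_one_of_kerRow I 𝔡 y L q K hK h1
    (M := (sch₀Of 𝓜 w (serreTensor I.act E' hE') (red₀Of S Kc 𝓜 w h𝓨 e (quotΩ y L))).X) (qbarOf y L) (hσ y).1 (hσ y).2 hK3
  exact hk


/-! (★ re-home, size lint: PART 3 of 4 ends here at tree line :902; continued in `Theorems/F0P6aStubFROBRoofGeoWiring.lean`.) -/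

end KillWitness
end Summit.HodgeConjecture.HodgeConjecture.Cruxes.HLiu418.F0P6aStubFROBRoofGeoWiring
end
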